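import Literature.AlgebraicGeometry.Morphisms.SectionsFlatBaseChange
import Literature.AlgebraicGeometry.Morphisms.CechH1PullbackComp
import Literature.AlgebraicGeometry.Motives.Varieties
import HarnessLib

/-!
# The absolute flat model `Γ(V, 𝒪_P) ⊗_K R ≅ Γ(pr_P⁻¹V, 𝒪_{P ×_K Spec R})` over a field

For a scheme `P → Spec K` over a field `K`, an open `V ⊆ P` and a commutative `K`-algebra `R`, with
`X := P ×_K Spec R` realised as Mathlib's chosen pullback `pullback P.hom s` along ANY structure morphism
`s : Spec R → Spec K` propositionally equal to `Spec (K → R)` (so that both `specOver K R` and the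
infinitesimal neighbourhoods `thickeningPt T t n` of `Motives/TheoremOfCubeThickenings` are instances,
see `Motives/ThickeningArtinianPoints`):

* `isAffineOpen_fst_preimage` — `pr_P⁻¹V` is affine for `V` affine (`pr_P` is an affine morphism);
* `absModelHom` / `absModelEquiv` — **`Γ(V, 𝒪_P) ⊗_K R ≃ₐ[K] Γ(pr_P⁻¹V, 𝒪_X)`**,
  `c ⊗ r ↦ pr_P^*(c) · pr_R^*(r)`, bijective for `V` affine: the tree's flat base change of `H⁰`
  (`Literature.AlgebraicGeometry.Morphisms.bcSections_bijective`, The Stacks Project, Tag 02KH in degree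
  `0`, with `A := K`, `B := R`, every `K`-module being flat) read in the order `Sections P.hom V ⊗[K] R`
  (`Algebra.TensorProduct.comm`);
* `res_absModelHom`, `absModelHom_map_res` — naturality in `V` (restriction);
* naturality in `R` (the transition morphisms of a `K`-algebra map `ψ : R → R'`) is in the sibling file
  `Motives/AbsoluteFlatModelTransition`.

This is the model by which line bundles on `P × Spec R`, `R` a local Artinian `K`-algebra, are read as
unit Čech cocycles with coefficients in `R` (Görtz–Wedhorn II, Lemma 24.72, proof, Step (I): the schemes
`X_A = X ×_S Spec A`; Mumford, *Abelian Varieties*, §13). Pattern: `Motives/ThickeningModel`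
(`isPushout_thick`, `modelEquiv`: the same model relative to an affine open of a base scheme `T`).
Everything is proved; no named facts. Mathlib searched (pin): `isIso_pushoutSection_of_isAffineOpen`
(through the tree's `bcSections_bijective`), `IsAffineOpen.preimage`, `MorphismProperty.pullback_fst`,
`pullback.map`, `Scheme.Hom.appLE_comp_appLE`, `Scheme.ΓSpecIso_inv_naturality` (used).

## References

* The Stacks Project, Tag 02KH (Cohomology of Schemes, Lemma 30.5.2: flat base change), degree `0`.
  [StacksProject]
* The Stacks Project, Tag 02KG (Lemma 30.5.1), Tag 02KE (Section 30.5), Tag 01S8 / 01SD / 01SH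
  (Morphisms, Lemmas 29.11.3 / 29.11.9 / 29.11.13: affine morphisms). [StacksProject]
* U. Görtz, T. Wedhorn, *Algebraic Geometry I: Schemes*, 2nd ed., Springer Spektrum (2020): Section (4.7),
  pp. 107–108 (base change, transitivity of base change). [GortzWedhorn2020]
* U. Görtz, T. Wedhorn, *Algebraic Geometry II: Cohomology of Schemes*, Springer Spektrum (2023),
  doi:10.1007/978-3-658-43031-3: Lemma 24.72 (p. 409), proof, Step (I) (p. 410). [GortzWedhorn2023]
-/

universe u

open CategoryTheory CategoryTheory.Limits AlgebraicGeometry TopologicalSpace Opposite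
open TensorProduct
open Literature.AlgebraicGeometry.Morphisms

noncomputable section

namespace Literature.AlgebraicGeometry.Motives

/-! ## §1 The absolute flat model `Γ(V) ⊗_K R ≅ Γ(pr_P⁻¹V)` -/

section AbsModel

variable {K : Type u} [Field K] (P : SchemeOver K) {R : Type u} [CommRing R] [Algebra K R]
  (s : Spec (CommRingCat.of R) ⟶ Spec (CommRingCat.of K))

/-- The first projection `P ×_K Spec R → P` composed with `P → Spec K` is the `K`-structure
`P ×_K Spec R → Spec R → Spec K` of the tree's `restrictBase` (for `s = Spec (K → R)`). [cite: GortzWedhorn2020, Section (4.7) (pp. 107–108)] -/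
theorem fst_comp_eq_restrictBase (hs : s = Spec.map (CommRingCat.ofHom (algebraMap K R))) :
    pullback.fst P.hom s ≫ P.hom = restrictBase K (pullback.snd P.hom s) := by
  subst hs
  exact pullback.condition

/-- The square `P ×_K Spec R ⇉ P, Spec R → Spec K` is cartesian, with the bottom arrow written as
`Spec (K → R)`. [cite: GortzWedhorn2020, Section (4.7) (pp. 107–108)] -/
theorem isPullback_fst_snd_algebraMap (hs : s = Spec.map (CommRingCat.ofHom (algebraMap K R))) :
    IsPullback (pullback.fst P.hom s) (pullback.snd P.hom s) P.hom
      (Spec.map (CommRingCat.ofHom (algebraMap K R))) := by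
  subst hs
  exact IsPullback.of_hasPullback _ _

omit [Algebra K R] in
/-- `pr_P : P ×_K Spec R → P` is an affine morphism (base change of the affine morphism
`Spec R → Spec K`). [cite: StacksProject, Tag 01SD (Morphisms, Lemma 29.11.9) and Tag 01SH (Morphisms, Lemma 29.11.13)] -/
theorem isAffineHom_fst : IsAffineHom (pullback.fst P.hom s) :=
  MorphismProperty.pullback_fst _ _ inferInstance

omit [Algebra K R] in
/-- **(α1)** The preimage `pr_P⁻¹V ⊆ P ×_K Spec R` of an affine open `V ⊆ P` is affine. [cite: StacksProject, Tag 01S8 (Morphisms, Lemma 29.11.3) and Tag 01SD (Morphisms, Lemma 29.11.9)] -/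
theorem isAffineOpen_fst_preimage {V : P.left.Opens} (hV : IsAffineOpen V) :
    IsAffineOpen (pullback.fst P.hom s ⁻¹ᵁ V) :=
  haveI := isAffineHom_fst P s
  hV.preimage _

omit [Algebra K R] in
/-- Preimages commute with intersections (definitional; recorded for rewriting). [cite: GortzWedhorn2020, Section (4.7) (pp. 107–108)] -/
theorem fst_preimage_inf (V W : P.left.Opens) :
    pullback.fst P.hom s ⁻¹ᵁ (V ⊓ W) = pullback.fst P.hom s ⁻¹ᵁ V ⊓ pullback.fst P.hom s ⁻¹ᵁ W :=
  rfl

variable (hs : s = Spec.map (CommRingCat.ofHom (algebraMap K R)))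

/-- **(α2) The absolute model map** `Γ(V, 𝒪_P) ⊗_K R → Γ(W, 𝒪_{P × Spec R})` for `W ⊆ pr_P⁻¹V`,
`c ⊗ r ↦ pr_P^*(c)|_W · pr_R^*(r)|_W`, a `K`-algebra homomorphism (the tree's `bcSections` for the
cartesian square `P ×_K Spec R`, precomposed with `Algebra.TensorProduct.comm`).
[cite: StacksProject, Tag 02KG (Cohomology of Schemes, Lemma 30.5.1) and Tag 02KH (Lemma 30.5.2), degree 0] -/
def absModelHom {V : P.left.Opens} {W : (pullback P.hom s).Opens}
    (e : W ≤ pullback.fst P.hom s ⁻¹ᵁ V) :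
    Sections P.hom V ⊗[K] R →ₐ[K] Sections (restrictBase K (pullback.snd P.hom s)) W :=
  (bcSections P.hom (pullback.snd P.hom s) (pullback.fst P.hom s)
      (fst_comp_eq_restrictBase P s hs) e).comp
    (Algebra.TensorProduct.comm K (Sections P.hom V) R).toAlgHom

/-- The absolute model map on pure tensors: `c ⊗ r ↦ pr_P^*(c)|_W · pr_R^*(r)|_W`. [cite: StacksProject, Tag 02KG (Cohomology of Schemes, Lemma 30.5.1) and Tag 02KH (Lemma 30.5.2), degree 0] -/
theorem absModelHom_tmul {V : P.left.Opens} {W : (pullback P.hom s).Opens}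
    (e : W ≤ pullback.fst P.hom s ⁻¹ᵁ V) (c : Sections P.hom V) (r : R) :
    absModelHom P s hs e (c ⊗ₜ r) =
      Sections.comap P.hom (restrictBase K (pullback.snd P.hom s)) (pullback.fst P.hom s)
          (fst_comp_eq_restrictBase P s hs) e c *
        toSectionsBase K (pullback.snd P.hom s) W r := by
  change bcSections P.hom (pullback.snd P.hom s) (pullback.fst P.hom s)
      (fst_comp_eq_restrictBase P s hs) e (Algebra.TensorProduct.comm K _ _ (c ⊗ₜ r)) = _
  rw [Algebra.TensorProduct.comm_tmul, bcSections, Algebra.TensorProduct.productMap_apply_tmul,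
    mul_comm]

/-- `pr_R^*(r)|_W` unfolded: the tree's `toSectionsBase` is `pr_R^♯` on `Γ(Spec R, 𝒪) = R`
(Mathlib `Scheme.ΓSpecIso`) followed by restriction. [cite: StacksProject, Tag 02KG (Cohomology of Schemes, Lemma 30.5.1) and Tag 02KH (Lemma 30.5.2), degree 0] -/
theorem toSectionsBase_eq_appLE (W : (pullback P.hom s).Opens) (r : R) :
    toSectionsBase K (pullback.snd P.hom s) W r =
      (pullback.snd P.hom s).appLE ⊤ W le_top ((Scheme.ΓSpecIso (.of R)).inv r) :=
  rfl

/-- `pr_P^*(c)|_W` unfolded: the tree's `Sections.comap` is Mathlib's `Scheme.Hom.appLE`. [cite: StacksProject, Tag 02KG (Cohomology of Schemes, Lemma 30.5.1) and Tag 02KH (Lemma 30.5.2), degree 0] -/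
theorem comap_fst_eq_appLE {V : P.left.Opens} {W : (pullback P.hom s).Opens}
    (e : W ≤ pullback.fst P.hom s ⁻¹ᵁ V) (c : Sections P.hom V) :
    Sections.comap P.hom (restrictBase K (pullback.snd P.hom s)) (pullback.fst P.hom s)
        (fst_comp_eq_restrictBase P s hs) e c = (pullback.fst P.hom s).appLE V W e c :=
  rfl

/-- The absolute model map on `c ⊗ 1` is `pr_P^*`. [cite: StacksProject, Tag 02KG (Cohomology of Schemes, Lemma 30.5.1) and Tag 02KH (Lemma 30.5.2), degree 0] -/
theorem absModelHom_tmul_one {V : P.left.Opens} {W : (pullback P.hom s).Opens}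
    (e : W ≤ pullback.fst P.hom s ⁻¹ᵁ V) (c : Sections P.hom V) :
    absModelHom P s hs e (c ⊗ₜ 1) =
      Sections.comap P.hom (restrictBase K (pullback.snd P.hom s)) (pullback.fst P.hom s)
        (fst_comp_eq_restrictBase P s hs) e c := by
  rw [absModelHom_tmul, map_one, mul_one]

/-- The absolute model map on `1 ⊗ r` is `pr_R^*`. [cite: StacksProject, Tag 02KG (Cohomology of Schemes, Lemma 30.5.1) and Tag 02KH (Lemma 30.5.2), degree 0] -/
theorem absModelHom_one_tmul {V : P.left.Opens} {W : (pullback P.hom s).Opens}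
    (e : W ≤ pullback.fst P.hom s ⁻¹ᵁ V) (r : R) :
    absModelHom P s hs e (1 ⊗ₜ r) = toSectionsBase K (pullback.snd P.hom s) W r := by
  rw [absModelHom_tmul, map_one, one_mul]

/-- `R`-linearity of the absolute model map: `x · (1 ⊗ r) ↦ absModelHom x · pr_R^*(r)`. [cite: StacksProject, Tag 02KG (Cohomology of Schemes, Lemma 30.5.1) and Tag 02KH (Lemma 30.5.2), degree 0] -/
theorem absModelHom_mul_one_tmul {V : P.left.Opens} {W : (pullback P.hom s).Opens}
    (e : W ≤ pullback.fst P.hom s ⁻¹ᵁ V) (x : Sections P.hom V ⊗[K] R) (r : R) :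
    absModelHom P s hs e (x * (1 ⊗ₜ r)) =
      absModelHom P s hs e x * toSectionsBase K (pullback.snd P.hom s) W r := by
  rw [map_mul, absModelHom_one_tmul]

/-- **(α2) The absolute model map is bijective on `W = pr_P⁻¹V` for `V` affine** (flat base change
of `H⁰`: the tree's `bcSections_bijective`; `V` affine is quasi-compact and quasi-separated, `R` is
flat over the field `K`). [cite: StacksProject, Tag 02KG (Cohomology of Schemes, Lemma 30.5.1) and Tag 02KH (Lemma 30.5.2), degree 0] -/
theorem absModelHom_bijective {V : P.left.Opens} (hV : IsAffineOpen V) :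
    Function.Bijective (absModelHom P s hs (le_refl (pullback.fst P.hom s ⁻¹ᵁ V))) :=
  (bcSections_bijective P.hom (pullback.snd P.hom s) (pullback.fst P.hom s)
      (isPullback_fst_snd_algebraMap P s hs) hV.isCompact hV.isQuasiSeparated).comp
    (Algebra.TensorProduct.comm K (Sections P.hom V) R).bijective

/-- **(α2) THE ABSOLUTE FLAT MODEL** `Γ(V, 𝒪_P) ⊗_K R ≃ₐ[K] Γ(pr_P⁻¹V, 𝒪_{P ×_K Spec R})`,
`c ⊗ r ↦ pr_P^*(c) · pr_R^*(r)`, for `V ⊆ P` affine. [cite: StacksProject, Tag 02KG (Cohomology of Schemes, Lemma 30.5.1) and Tag 02KH (Lemma 30.5.2), degree 0] -/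
def absModelEquiv {V : P.left.Opens} (hV : IsAffineOpen V) :
    Sections P.hom V ⊗[K] R ≃ₐ[K]
      Sections (restrictBase K (pullback.snd P.hom s)) (pullback.fst P.hom s ⁻¹ᵁ V) :=
  AlgEquiv.ofBijective _ (absModelHom_bijective P s hs hV)

/-- `absModelEquiv` is `absModelHom`. [cite: StacksProject, Tag 02KG (Cohomology of Schemes, Lemma 30.5.1) and Tag 02KH (Lemma 30.5.2), degree 0] -/
@[simp] theorem absModelEquiv_apply {V : P.left.Opens} (hV : IsAffineOpen V)
    (x : Sections P.hom V ⊗[K] R) :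
    absModelEquiv P s hs hV x = absModelHom P s hs (le_refl _) x :=
  rfl

/-- `absModelEquiv` on pure tensors. [cite: StacksProject, Tag 02KG (Cohomology of Schemes, Lemma 30.5.1) and Tag 02KH (Lemma 30.5.2), degree 0] -/
theorem absModelEquiv_tmul {V : P.left.Opens} (hV : IsAffineOpen V) (c : Sections P.hom V) (r : R) :
    absModelEquiv P s hs hV (c ⊗ₜ r) =
      (pullback.fst P.hom s).appLE V _ le_rfl c *
        (pullback.snd P.hom s).appLE ⊤ _ le_top ((Scheme.ΓSpecIso (.of R)).inv r) :=
  absModelHom_tmul P s hs _ c r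

/-! ### (α3) Naturality in `V`: restriction -/

/-- `pr_R^*` is compatible with restriction. [cite: StacksProject, Tag 02KG (Cohomology of Schemes, Lemma 30.5.1) and Tag 02KH (Lemma 30.5.2), degree 0] -/
theorem res_toSectionsBase {W W' : (pullback P.hom s).Opens} (h : W' ≤ W) (r : R) :
    Sections.res (restrictBase K (pullback.snd P.hom s)) h
        (toSectionsBase K (pullback.snd P.hom s) W r) =
      toSectionsBase K (pullback.snd P.hom s) W' r :=
  (Sections.res (pullback.snd P.hom s) h).commutes r

/-- **(α3, target side)** restriction after the model map:
`res_{W'} ∘ absModelHom_W = absModelHom_{W'}`. [cite: StacksProject, Tag 02KG (Cohomology of Schemes, Lemma 30.5.1) and Tag 02KH (Lemma 30.5.2), degree 0] -/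
theorem res_absModelHom {V : P.left.Opens} {W W' : (pullback P.hom s).Opens}
    (e : W ≤ pullback.fst P.hom s ⁻¹ᵁ V) (h : W' ≤ W) (x : Sections P.hom V ⊗[K] R) :
    Sections.res (restrictBase K (pullback.snd P.hom s)) h (absModelHom P s hs e x) =
      absModelHom P s hs (h.trans e) x := by
  induction x using TensorProduct.induction_on with
  | zero => simp only [map_zero]
  | add x y hx hy => simp only [map_add, hx, hy]
  | tmul c r =>
    rw [absModelHom_tmul, absModelHom_tmul, map_mul, Sections.res_comap, res_toSectionsBase]

/-- **(α3, source side)** the model map after `res ⊗ id`: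
`absModelHom_W ∘ (res_{V' ⊆ V} ⊗ id_R) = absModelHom_W` (the unit-cocycle calculus' `resR` is
`Algebra.TensorProduct.map (Sections.res _ h) (AlgHom.id _ _)`). [cite: StacksProject, Tag 02KG (Cohomology of Schemes, Lemma 30.5.1) and Tag 02KH (Lemma 30.5.2), degree 0] -/
theorem absModelHom_map_res {V V' : P.left.Opens} (h : V' ≤ V) {W : (pullback P.hom s).Opens}
    (e : W ≤ pullback.fst P.hom s ⁻¹ᵁ V') (x : Sections P.hom V ⊗[K] R) :
    absModelHom P s hs e (Algebra.TensorProduct.map (Sections.res P.hom h) (AlgHom.id K R) x) =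
      absModelHom P s hs (e.trans fun _ hy => h hy) x := by
  induction x using TensorProduct.induction_on with
  | zero => simp only [map_zero]
  | add x y hx hy => simp only [map_add, hx, hy]
  | tmul c r =>
    rw [Algebra.TensorProduct.map_tmul, absModelHom_tmul, absModelHom_tmul, AlgHom.id_apply,
      Sections.comap_res]

end AbsModel

end Literature.AlgebraicGeometry.Motives

end
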